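import Summits.Ventures.Crystal3D.Theorems.StickyWulffConstantCoaxialWallLawLaminarLocal
import Summits.Ventures.Crystal3D.Theorems.StickyWulffConstantCoaxialWallLawHexagonRigidity
import HarnessLib

/-!
# The laminar end law: an in-layer run end with predecessor has at most eleven contacts

HONEST FRAMING. Part of the venture `Summits/Ventures/Crystal3D` (cell `crystal3d-full`), helper
`--supports` the crux `CoaxialWallLaw` (stmt-Ventures-19481, `route-Ventures-StickyWulffConstant`),
REGISTERED line `WallLedgerF` (planner cf-p1 gen 16), open stub `stub_coaxialTwoSlabAdhesion`.
RUNG CREDIT ONLY (fourth brick of the LAMINAR rung); F-C1 not moved.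

A filling `X` is LAMINAR for the frame `(L, s)` when every ball lies in a basal plane
`⟪L⁻¹(p − s), e₃⟫ ∈ √(2/3)·ℤ` (in-plane positions arbitrary).  Combining the two landed bricks:

* `…LaminarLocal.laminar_card_contacts_le`: `deg z ≤ deg₂ z + 6` (`deg₂` = contacts in the own layer);
* `…HexagonRigidity.inPlane_six_antipode`: six coplanar unit vectors pairwise at `⟪·,·⟫ ≤ ½` contain each
  other's antipodes;

we get the local law the laminar rung charges:

* **`laminar_inLayer_card_le_five_of_end`** — `z ∈ X`, `d` a unit vector of the basal plane (`⟪d, L e₃⟫ = 0`),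
  `z − d ∈ X`, `z + d ∉ X` ⇒ `deg₂ z ≤ 5` (six in-layer contacts would contain `−(−d) = d`).
* **`laminar_card_contacts_le_eleven_of_end`** — hence `deg z ≤ 11`: an in-plane run END WITH PREDECESSOR pays
  one missing contact AT ITSELF (multiplicity one, no census, no kissing facts beyond the planar hexagon).

WHAT THIS IS NOT: no count; F-C1 not moved.
-/

noncomputable section

namespace Summit.Ventures.Crystal3D.Theorems

open Summit.Ventures.Crystal3D Finset
open scoped InnerProductSpace

open scoped Classical in
/-- **At most five in-layer contacts at an in-plane run end with predecessor** (laminar fillings).  See the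
module docstring. -/
theorem laminar_inLayer_card_le_five_of_end
    (L : EuclideanSpace ℝ (Fin 3) ≃ₗᵢ[ℝ] EuclideanSpace ℝ (Fin 3)) (s : EuclideanSpace ℝ (Fin 3))
    (X : Finset (EuclideanSpace ℝ (Fin 3)))
    (hX : ∀ p ∈ X, ∀ q ∈ X, p ≠ q → 1 ≤ dist p q)
    {z d : EuclideanSpace ℝ (Fin 3)} (hd1 : ‖d‖ = 1)
    (hdn : ⟪d, L (EuclideanSpace.single (2 : Fin 3) (1 : ℝ))⟫_ℝ = 0)
    (hpred : z - d ∈ X) (hsucc : z + d ∉ X) :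
    (X.filter fun q => dist z q = 1 ∧ (L.symm (q - s)) 2 = (L.symm (z - s)) 2).card ≤ 5 := by
  set e₃ : EuclideanSpace ℝ (Fin 3) := EuclideanSpace.single (2 : Fin 3) (1 : ℝ) with he₃
  set n : EuclideanSpace ℝ (Fin 3) := L e₃ with hn
  set C₂ := X.filter fun q => dist z q = 1 ∧ (L.symm (q - s)) 2 = (L.symm (z - s)) 2 with hC₂
  have he₃1 : ‖e₃‖ = 1 := by rw [he₃, PiLp.norm_single, norm_one]
  have hn1 : ‖n‖ = 1 := by rw [hn, LinearIsometryEquiv.norm_map, he₃1]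
  -- frame height of a difference
  have hheight : ∀ q : EuclideanSpace ℝ (Fin 3), ⟪q - z, n⟫_ℝ = (L.symm (q - s)) 2 - (L.symm (z - s)) 2 := by
    intro q
    have e : q - z = L (L.symm (q - s) - L.symm (z - s)) := by
      rw [map_sub, LinearIsometryEquiv.apply_symm_apply, LinearIsometryEquiv.apply_symm_apply]; abel
    rw [e, hn, LinearIsometryEquiv.inner_map_map, EuclideanSpace.inner_single_right, PiLp.sub_apply]
    simp
  by_contra h6
  push Not at h6
  -- the in-layer contact directions
  set S : Finset (EuclideanSpace ℝ (Fin 3)) := C₂.image fun q => q - z with hS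
  have hinj : Set.InjOn (fun q : EuclideanSpace ℝ (Fin 3) => q - z) ↑C₂ := fun a _ b _ h => sub_left_injective h
  have hScard : 6 ≤ S.card := by rw [hS, card_image_of_injOn hinj]; omega
  have hS1 : ∀ u ∈ S, ‖u‖ = 1 := by
    intro u hu
    obtain ⟨q, hq, rfl⟩ := mem_image.1 hu
    rw [← dist_eq_norm, dist_comm]; exact (mem_filter.1 hq).2.1
  have hSn : ∀ u ∈ S, ⟪u, n⟫_ℝ = 0 := by
    intro u hu
    obtain ⟨q, hq, rfl⟩ := mem_image.1 hu
    rw [hheight, (mem_filter.1 hq).2.2, sub_self]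
  have hSsep : ∀ u ∈ S, ∀ u' ∈ S, u ≠ u' → ⟪u, u'⟫_ℝ ≤ 1 / 2 := by
    intro u hu u' hu' huu'
    obtain ⟨q, hq, rfl⟩ := mem_image.1 hu
    obtain ⟨q', hq', rfl⟩ := mem_image.1 hu'
    have hqX := (mem_filter.1 hq).1
    have hq'X := (mem_filter.1 hq').1
    have hne : q ≠ q' := fun h => huu' (by rw [h])
    have hd := hX q hqX q' hq'X hne
    have hu1 : ‖q - z‖ = 1 := by rw [← dist_eq_norm, dist_comm]; exact (mem_filter.1 hq).2.1
    have hu1' : ‖q' - z‖ = 1 := by rw [← dist_eq_norm, dist_comm]; exact (mem_filter.1 hq').2.1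
    have hdd : dist q q' = ‖(q - z) - (q' - z)‖ := by rw [dist_eq_norm]; congr 1; abel
    have hexp : ‖(q - z) - (q' - z)‖ ^ 2 = ‖q - z‖ ^ 2 - 2 * ⟪q - z, q' - z⟫_ℝ + ‖q' - z‖ ^ 2 :=
      norm_sub_sq_real _ _
    rw [hu1, hu1', ← hdd] at hexp
    nlinarith [hexp, hd]
  -- the predecessor direction `−d` is one of them
  have hpredC : z - d ∈ C₂ := by
    rw [hC₂, mem_filter]
    refine ⟨hpred, by rw [dist_eq_norm, sub_sub_cancel, hd1], ?_⟩
    have h := hheight (z - d)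
    rw [show z - d - z = -d by abel, inner_neg_left, hdn, neg_zero] at h
    linarith
  have ha : -d ∈ S := mem_image.2 ⟨z - d, hpredC, by abel⟩
  -- hence so is `d`, i.e. `z + d ∈ X`
  have hdS : -(-d) ∈ S := inPlane_six_antipode hn1 S hS1 hSn hSsep hScard ha
  rw [neg_neg] at hdS
  obtain ⟨q, hq, hqd⟩ := mem_image.1 hdS
  have hqe : q = z + d := by rw [← hqd]; abel
  exact hsucc (hqe ▸ (mem_filter.1 hq).1)

open scoped Classical in
/-- **The laminar end law: an in-plane run end with predecessor has at most eleven contacts.**  See the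
module docstring. -/
theorem laminar_card_contacts_le_eleven_of_end
    (L : EuclideanSpace ℝ (Fin 3) ≃ₗᵢ[ℝ] EuclideanSpace ℝ (Fin 3)) (s : EuclideanSpace ℝ (Fin 3))
    (X : Finset (EuclideanSpace ℝ (Fin 3)))
    (hX : ∀ p ∈ X, ∀ q ∈ X, p ≠ q → 1 ≤ dist p q)
    (hlam : ∀ p ∈ X, ∃ k : ℤ, (L.symm (p - s)) 2 = k * Real.sqrt (2 / 3))
    {z d : EuclideanSpace ℝ (Fin 3)} (hz : z ∈ X) (hd1 : ‖d‖ = 1)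
    (hdn : ⟪d, L (EuclideanSpace.single (2 : Fin 3) (1 : ℝ))⟫_ℝ = 0)
    (hpred : z - d ∈ X) (hsucc : z + d ∉ X) :
    (X.filter fun q => dist z q = 1).card ≤ 11 := by
  have h1 := laminar_card_contacts_le L s X hX hlam hz
  have h2 := laminar_inLayer_card_le_five_of_end L s X hX hd1 hdn hpred hsucc
  omega

end Summit.Ventures.Crystal3D.Theorems

end
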